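import Summits.ResolutionOfSingularities.ResolutionOfSingularities.Theorems.MarkedTransferCampaignW21ExponentZeroWitness
import Summits.ResolutionOfSingularities.ResolutionOfSingularities.Theorems.MarkedTransferCampaignW21TopDegreeLe
import HarnessLib

/-!
# [OURS · L1 W2.1] The UNRESTRICTED Case-(I) order bound fails for every prime `p` (at `e = 1`): the class restriction
# of `OrderBoundOnPos p C` is necessary

Rung L (rescue) of cell res-hironaka, RESCUE-SEED row L-G2, slot W2.1, seat res-L1-s21-pv-1. The W2.1 vocabulary
(`MarkedTransferCampaignW21OrderBoundInClass.lean` v5, `…OrderBoundPos.lean` p469452, `…MinedHypothesis.lean` p470654;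
res-L1-type-o3) states the Case-(I) order bound `ord ε ≤ ord H♭(ε)` ON A CLASS `C` (`OrderBoundOnPos p C`, `e > 0`) and
deliberately does NOT state the unrestricted slice `C = ⊤` (GAP row R05 / reading S-I, proposed DOES-NOT-FOLLOW-AS-PRINTED
on the 𝔽₂ witness W2 of res-adj-2, cell evidence `ledger/evidence/R05/R05_W2.lean`). The positive results of this seat
(`orderBoundInClassPos_holds`, `orderBoundExactPos_holds`, p473059 / p474444) hold on `LucasClass ⊆ ExactClass`.

THIS FILE closes the bracket in the tree, in the W2.1 vocabulary and for EVERY prime `p`: the W2-type datum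
`ε = y x^{2p} + y x^{p} + x^{2p} ∈ 𝔽_p⟦y, x⟧` with the depth-3 standard expression
`{(a;b;c)} = {((1,0);0;(0,2)), ((1,0);0;(0,1)), (0;0;(0,2))}` (`e = 1`, `q = p`, all coefficients `1`) has top pair
`((1,0), 0)`, top block `{γ₀ = (0,2) >lex γ₁ = (0,1)}`, satisfies `Standing` (`u₀ = 1`, `α ≠ 0`, `ord ε = p + 1 > p = q`,
`|α + pβ + qγ₀| = 2p + 1 < p³`) and Case (I) (`|qγ₀| = 2p ≥ 2q`), but `H♭(ε) = ∂^{(1,0)}ε · ∂^{(0,2p)}ε =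
(x^{2p} + x^p)(y + 1)` has order `p < p + 1 = ord ε`. Hence `not_orderBoundOnPos_top : ¬ OrderBoundOnPos p ⊤`,
`not_orderBoundOn_top : ¬ OrderBoundOn p ⊤`, and — through `displayedChainIffTopDegreeLe_holds` (p475843) —
`not_displayedChainOn_top : ¬ DisplayedChainOn p ⊤`: the AS-PRINTED display of Rem. 9.9 (1), read in `K⟦x⟧` without a
class restriction, fails for every prime (the datum has `|α+pβ+qγ₀| = 2p+1 > p+1 = ord ε`, i.e. lies outside class (D),
and outside `LucasClass` / `ExactClass`: `min_j |γ_j| = 1`, `q|γ₀| = 2p > p + 1`). At `p = 2` this is exactly W2.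
Everything here is OURS / folklore about OURS statements; nothing is a statement of or about the manuscript under
adjudication (GAP row R05); AI-produced formalisation, expert review is stronger than AI review.
-/

noncomputable section

set_option linter.dupNamespace false -- mandated namespace of this single-conjunct summit

namespace Summit.ResolutionOfSingularities.ResolutionOfSingularities.Theorems

namespace CampaignW21

open Literature.AlgebraicGeometry.Hironaka2017.S08UnitMonomial
open Literature.AlgebraicGeometry.Hironaka2017.S09LLUED
open Literature.AlgebraicGeometry.Hironaka2017.S09LLUED.TopFrontier
open Literature.AlgebraicGeometry.Resolution
open Literature.RingTheory.MvPowerSeries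
open MvPowerSeries Finsupp

/-! ## The W2-type witness datum at `e = 1` over `𝔽_p` -/

namespace UnrestrictedWitness

open ExponentZeroWitness

variable (p : ℕ) [hp : Fact p.Prime]

/-- The witness `ε = y x^{2p} + y x^{p} + x^{2p}` (`y = X 0`, `x = X 1`). [folklore] -/
def eps : R p := X 0 * X 1 ^ (2 * p) + X 0 * X 1 ^ p + X 1 ^ (2 * p)

omit hp in
/-- [folklore] -/
theorem smul_ex (k a b : ℕ) : k • ex a b = ex (k * a) (k * b) := by
  ext i; fin_cases i <;> simp [ex]

/-- `ε` as a sum of three monomials. [folklore] -/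
theorem eps_eq : eps p = monomial (ex 1 (2 * p)) 1 + monomial (ex 1 p) 1 + monomial (ex 0 (2 * p)) 1 := by
  simp only [eps, X1_pow_eq, X0_eq, monomial_mul_monomial, ex_add, mul_one, add_zero, zero_add]

/-- `∂^{(1,0)} ε = x^{2p} + x^p`. [folklore] -/
theorem hd_10 : hasseDeriv (ex 1 0) (eps p) = monomial (ex 0 (2 * p)) 1 + monomial (ex 0 p) 1 := by
  rw [eps_eq, map_add, map_add, hasseDeriv_ex_monomial_of_le p le_rfl (Nat.zero_le _),
    hasseDeriv_ex_monomial_of_le p le_rfl (Nat.zero_le _), hasseDeriv_ex_monomial_of_not_le p (by omega)]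
  simp

/-- `∂^{(0,2p)} ε = y + 1`. [folklore] -/
theorem hd_02p : hasseDeriv (ex 0 (2 * p)) (eps p) = monomial (ex 1 0) 1 + monomial 0 1 := by
  have hp1 : 1 ≤ p := hp.out.one_lt.le
  rw [eps_eq, map_add, map_add, hasseDeriv_ex_monomial_of_le p (Nat.zero_le 1) le_rfl,
    hasseDeriv_ex_monomial_of_not_le p (by omega), hasseDeriv_ex_monomial_of_le p le_rfl le_rfl]
  simp [ex_zero_zero]

/-- `∂^{(1,0)}ε · ∂^{(0,2p)}ε = y x^{2p} + x^{2p} + y x^p + x^p`. [folklore] -/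
theorem hd_prod : hasseDeriv (ex 1 0) (eps p) * hasseDeriv (ex 0 (2 * p)) (eps p) =
    monomial (ex 1 (2 * p)) 1 + monomial (ex 0 (2 * p)) 1 + monomial (ex 1 p) 1 + monomial (ex 0 p) 1 := by
  rw [hd_10, hd_02p, ← ex_zero_zero]
  simp only [add_mul, mul_add, monomial_mul_monomial, ex_add, mul_one, add_zero, zero_add]
  abel

/-- `ord (∂^{(1,0)}ε · ∂^{(0,2p)}ε) ≤ p` (the coefficient of `x^p` is `1`). [folklore] -/
theorem order_hd_prod_le :
    (hasseDeriv (ex 1 0) (eps p) * hasseDeriv (ex 0 (2 * p)) (eps p)).order ≤ ((p : ℕ) : ℕ∞) := by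
  have hp1 : 1 ≤ p := hp.out.one_lt.le
  have hc : coeff (ex 0 p) (hasseDeriv (ex 1 0) (eps p) * hasseDeriv (ex 0 (2 * p)) (eps p)) ≠ 0 := by
    rw [hd_prod, map_add, map_add, map_add, coeff_ex_monomial, coeff_ex_monomial, coeff_ex_monomial,
      coeff_ex_monomial, if_neg (by omega), if_neg (by omega), if_neg (by omega), if_pos ⟨rfl, rfl⟩]
    simp
  have := order_le hc
  rwa [ex_degree, zero_add] at this

/-- `ord ε = p + 1`. [folklore] -/
theorem order_eps : (eps p).order = ((p + 1 : ℕ) : ℕ∞) := by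
  have hp1 : 1 ≤ p := hp.out.one_lt.le
  apply le_antisymm
  · have hc : coeff (ex 1 p) (eps p) ≠ 0 := by
      rw [eps_eq, map_add, map_add, coeff_ex_monomial, coeff_ex_monomial, coeff_ex_monomial, if_neg (by omega),
        if_pos ⟨rfl, rfl⟩, if_neg (by omega)]
      simp
    have := order_le hc
    rwa [ex_degree, add_comm] at this
  · refine MvPowerSeries.le_order fun d hd => ?_
    classical
    have hd' : d.degree < p + 1 := by exact_mod_cast hd
    rw [eps_eq, map_add, map_add, coeff_monomial, coeff_monomial, coeff_monomial]
    rw [if_neg, if_neg, if_neg, add_zero, add_zero]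
    · rintro rfl; rw [ex_degree] at hd'; omega
    · rintro rfl; rw [ex_degree] at hd'; omega
    · rintro rfl; rw [ex_degree] at hd'; omega

/-- `ord_𝔪 ε = p + 1`. [folklore] -/
theorem adicOrder_eps : adicOrder (eps p) = ((p + 1 : ℕ) : ℕ∞) := by
  rw [adicOrder_eq_order, order_eps]

/-! ### The standard-expression datum (`e = 1`) and its top frontier -/

/-- The three index triples. [folklore] -/
def s₁ : ExpTriple 2 := (ex 1 0, 0, ex 0 2)
/-- [folklore] -/
def s₂ : ExpTriple 2 := (ex 1 0, 0, ex 0 1)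
/-- [folklore] -/
def s₃ : ExpTriple 2 := (0, 0, ex 0 2)
/-- The support. [folklore] -/
def T₁ : Finset (ExpTriple 2) := {s₁, s₂, s₃}

omit hp in
/-- [folklore] -/
theorem s₁_ne_s₂ : s₁ ≠ s₂ := fun h => by simpa [s₁, s₂, ex_apply_one] using congrArg (fun t : ExpTriple 2 => t.2.2 1) h
omit hp in
/-- [folklore] -/
theorem s₁_ne_s₃ : s₁ ≠ s₃ := fun h => by simpa [s₁, s₃, ex_apply_zero] using congrArg (fun t : ExpTriple 2 => t.1 0) h
omit hp in
/-- [folklore] -/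
theorem s₂_ne_s₃ : s₂ ≠ s₃ := fun h => by simpa [s₂, s₃, ex_apply_zero] using congrArg (fun t : ExpTriple 2 => t.1 0) h

omit hp in
/-- [folklore] -/
theorem mem_T₁ {t : ExpTriple 2} : t ∈ T₁ ↔ t = s₁ ∨ t = s₂ ∨ t = s₃ := by
  simp [T₁]

/-- [folklore] -/
theorem effSupport_T₁ : effSupport T₁ (uu p) = T₁ := by
  ext t; simp [effSupport, uu]

omit hp in
/-- [folklore] -/
theorem pairKey_le_T₁ (t : ExpTriple 2) (ht : t ∈ T₁) : pairKey t ≤ K₁ := by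
  rcases mem_T₁.1 ht with rfl | rfl | rfl
  · exact le_rfl
  · exact le_rfl
  · exact Prod.Lex.toLex_mono
      ⟨Finsupp.toLex_monotone (show (0 : Fin 2 →₀ ℕ) ≤ ex 1 0 from fun i => Nat.zero_le _), le_rfl⟩

/-- [folklore] -/
theorem topPair_T₁ : topPair T₁ (uu p) = (ex 1 0, 0) := by
  have h1 : s₁ ∈ effSupport T₁ (uu p) := by rw [effSupport_T₁]; exact mem_T₁.2 (Or.inl rfl)
  have hmax : ∀ h, ((effSupport T₁ (uu p)).image pairKey).max' h = K₁ := fun h =>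
    le_antisymm (Finset.max'_le _ _ _ fun k hk => by
        obtain ⟨t, ht, rfl⟩ := Finset.mem_image.1 hk
        exact pairKey_le_T₁ t (by rwa [effSupport_T₁] at ht))
      (Finset.le_max' _ K₁ ((Finset.mem_image (f := pairKey)).2 ⟨s₁, h1, rfl⟩))
  unfold topPair
  rw [dif_pos ⟨s₁, h1⟩]
  simp only [hmax]
  rfl

/-- `α = (1,0)`. [folklore] -/
theorem alpha_T₁ : alpha T₁ (uu p) = ex 1 0 := by rw [alpha, topPair_T₁]
/-- `β = 0`. [folklore] -/
theorem beta_T₁ : beta T₁ (uu p) = 0 := by rw [beta, topPair_T₁]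

/-- The top block `{y x^{2p}, y x^p}`. [folklore] -/
theorem topBlock_T₁ : topBlock T₁ (uu p) = {s₁, s₂} := by
  unfold topBlock
  rw [effSupport_T₁, alpha_T₁, beta_T₁]
  ext t
  simp only [Finset.mem_filter, mem_T₁, Finset.mem_insert, Finset.mem_singleton]
  constructor
  · rintro ⟨h | h | h, h1, -⟩
    · exact Or.inl h
    · exact Or.inr h
    · exfalso; subst h
      have h' := DFunLike.congr_fun h1 0
      simp [s₃, ex_apply_zero] at h'
  · rintro (rfl | rfl)
    · exact ⟨Or.inl rfl, rfl, rfl⟩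
    · exact ⟨Or.inr (Or.inl rfl), rfl, rfl⟩

/-- [folklore] -/
theorem mem_gammaKeys_T₁ {k : Lex (Fin 2 →₀ ℕ)} :
    k ∈ gammaKeys T₁ (uu p) ↔ k = toLex (ex 0 2) ∨ k = toLex (ex 0 1) := by
  unfold gammaKeys
  rw [topBlock_T₁, Finset.mem_image]
  constructor
  · rintro ⟨t, ht, rfl⟩
    simp only [Finset.mem_insert, Finset.mem_singleton] at ht
    rcases ht with rfl | rfl
    · exact Or.inl rfl
    · exact Or.inr rfl
  · rintro (rfl | rfl)
    · exact ⟨s₁, by simp, rfl⟩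
    · exact ⟨s₂, by simp, rfl⟩

omit hp in
/-- [folklore] -/
theorem toLex_ex02_ne : (toLex (ex 0 2) : Lex (Fin 2 →₀ ℕ)) ≠ toLex (ex 0 1) := fun h => by
  have := (ex_eq_iff.1 (toLex_inj.1 h)).2; omega

/-- `m + 1 = 2`. [folklore] -/
theorem frontierLength_T₁ : frontierLength T₁ (uu p) = 2 := by
  have : gammaKeys T₁ (uu p) = {toLex (ex 0 2), toLex (ex 0 1)} := by
    ext k; rw [mem_gammaKeys_T₁]; simp
  rw [frontierLength, this]
  exact Finset.card_pair toLex_ex02_ne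

/-- [folklore] -/
theorem frontierLength_T₁_pos : 0 < frontierLength T₁ (uu p) := by
  rw [frontierLength_T₁]; exact Nat.succ_pos 1

/-- `γ₀ = (0,2)` (the lexicographically largest top-block exponent). [folklore] -/
theorem gamma_zero_T₁ (h0 : 0 < frontierLength T₁ (uu p)) : gamma T₁ (uu p) ⟨0, h0⟩ = ex 0 2 := by
  have hmax : ∀ h, (gammaKeys T₁ (uu p)).max' h = toLex (ex 0 2) := fun h =>
    le_antisymm (Finset.max'_le _ _ _ fun k hk => by
        rcases (mem_gammaKeys_T₁ p).1 hk with rfl | rfl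
        · exact le_rfl
        · exact Finsupp.toLex_monotone (ex_le_iff.2 ⟨le_rfl, by omega⟩))
      (Finset.le_max' _ _ ((mem_gammaKeys_T₁ p).2 (Or.inl rfl)))
  have key : ∀ (k : ℕ) (hk : (gammaKeys T₁ (uu p)).card = k) (i : Fin k), i.val = k - 1 →
      ofLex ((gammaKeys T₁ (uu p)).orderEmbOfFin hk i) = ex 0 2 := by
    rintro k hk ⟨i, hi⟩ (h : i = k - 1)
    subst h
    rw [Finset.orderEmbOfFin_last hk (by omega), hmax]
    rfl
  exact key _ rfl _ (by simp [Fin.val_rev])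

/-- **The depth-3 standard expression of `ε` with `e = 1`** (`q = p`; `a_i < p`, `b = 0 < p⁰`, coefficients `1 ∈ ρ³`).
[folklore] -/
def stdExpr : StandardExpression p (xs (ZMod p) 2) 1 3 (eps p) where
  support := T₁
  u := uu p
  u_mem := fun _ _ => ⟨1, one_pow _⟩
  u_unit_or_zero := fun _ _ => Or.inl isUnit_one
  a_lt := by
    intro t ht i
    have h1 : 1 < p := hp.out.one_lt
    rcases mem_T₁.1 ht with rfl | rfl | rfl <;> fin_cases i <;>
      simp [s₁, s₂, s₃, ex_apply_zero, ex_apply_one] <;> omega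
  b_lt := by
    intro t ht j
    rcases mem_T₁.1 ht with rfl | rfl | rfl <;> fin_cases j <;> simp [s₁, s₂, s₃]
  sum_eq := by
    rw [T₁, Finset.sum_insert (by simp [s₁_ne_s₂, s₁_ne_s₃]), Finset.sum_insert (by simp [s₂_ne_s₃]),
      Finset.sum_singleton]
    simp only [Fin.prod_univ_two, s₁, s₂, s₃, xs, uu, ex_apply_zero, ex_apply_one, Finsupp.coe_zero,
      Pi.zero_apply, mul_zero, pow_zero, one_mul, mul_one, pow_one]
    simp only [eps]
    ring

/-- The `Standing` binders hold (`u₀ = 1`, `α ≠ 0`, `ord ε = p + 1 > p`, `|α+pβ+qγ₀| = 2p + 1 < p³`). [folklore] -/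
theorem standing : Standing p 1 3 (eps p) (stdExpr p) (frontierLength_T₁_pos p) where
  unit_u0 := isUnit_one
  alpha_ne := by
    intro h
    have h' := DFunLike.congr_fun (show alpha T₁ (uu p) = 0 from h) 0
    rw [alpha_T₁, ex_apply_zero] at h'
    exact one_ne_zero h'
  ord_lt := by
    show ((p ^ 1 : ℕ) : ℕ∞) < adicOrder (eps p)
    rw [pow_one, adicOrder_eps]
    exact_mod_cast Nat.lt_succ_self p
  depth := by
    show (alpha T₁ (uu p) + p • beta T₁ (uu p) + p ^ 1 • gamma T₁ (uu p) ⟨0, frontierLength_T₁_pos p⟩).degree < p ^ 3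
    rw [alpha_T₁, beta_T₁, gamma_zero_T₁, smul_zero, add_zero, pow_one, smul_ex, ex_add, ex_degree]
    have h2 : 2 ≤ p := hp.out.two_le
    have : 2 * 2 * p ≤ p ^ 3 := by
      rw [pow_succ, pow_two]
      exact Nat.mul_le_mul_right _ (Nat.mul_le_mul h2 h2)
    omega

/-- Case (I) of Lem. 9.6 holds: `|qγ₀| = 2p ≥ 2q`. [folklore] -/
theorem isCaseI : IsCaseI (p ^ 1) (gamma T₁ (uu p) ⟨0, frontierLength_T₁_pos p⟩) := by
  show 2 * p ^ 1 ≤ (p ^ 1 • gamma T₁ (uu p) ⟨0, frontierLength_T₁_pos p⟩).degree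
  rw [gamma_zero_T₁, pow_one, smul_ex, ex_degree]
  omega

/-- The Case-(I) value `H♭(ε) = ∂^{(1,0)}ε · ∂^{(0,2p)}ε` (the leading unit is `1`). [folklore] -/
theorem caseI_eq (u : (R p)ˣ) (hu : (u : R p) = 1) :
    HFlat.caseI (hasseD (ZMod p) 2) u p (p ^ 1) (alpha T₁ (uu p)) (beta T₁ (uu p))
        (gamma T₁ (uu p) ⟨0, frontierLength_T₁_pos p⟩) (eps p) =
      hasseDeriv (ex 1 0) (eps p) * hasseDeriv (ex 0 (2 * p)) (eps p) := by
  obtain rfl : u = 1 := Units.ext (by simpa using hu)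
  show (↑(1 : (R p)ˣ)⁻¹ : R p) * hasseDeriv (alpha T₁ (uu p) + p • beta T₁ (uu p)) (eps p) *
      hasseDeriv (p ^ 1 • gamma T₁ (uu p) ⟨0, frontierLength_T₁_pos p⟩) (eps p) = _
  rw [inv_one, Units.val_one, one_mul, alpha_T₁, beta_T₁, gamma_zero_T₁, smul_zero, add_zero, pow_one, smul_ex,
    mul_zero, mul_comm p 2]

/-- `ord H♭(ε) ≤ p < p + 1 = ord ε` for the witness. [folklore] -/
theorem adicOrder_caseI_le (u : (R p)ˣ) (hu : (u : R p) = 1) :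
    adicOrder (HFlat.caseI (hasseD (ZMod p) 2) u p (p ^ 1) (alpha T₁ (uu p)) (beta T₁ (uu p))
        (gamma T₁ (uu p) ⟨0, frontierLength_T₁_pos p⟩) (eps p)) ≤ ((p : ℕ) : ℕ∞) := by
  rw [caseI_eq p u hu, adicOrder_eq_order]
  exact order_hd_prod_le p

/-- The unit packaged by `Standing.unit_u0` is `1`. [folklore] -/
theorem standing_unit_eq : ((standing p).unit_u0.unit : R p) = 1 := IsUnit.unit_spec _

/-- The witness is NOT in class (D): `|α + pβ + qγ₀| = 2p + 1 > p + 1 = ord ε`. [folklore] -/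
theorem not_topDegreeLeOrder : ¬ TopDegreeLeOrder p 1 (eps p) (stdExpr p) := by
  intro h
  have h' := h (frontierLength_T₁_pos p)
  change ((alpha T₁ (uu p) + p • beta T₁ (uu p) + p ^ 1 • gamma T₁ (uu p) ⟨0, frontierLength_T₁_pos p⟩).degree :
    ℕ∞) ≤ adicOrder (eps p) at h'
  rw [alpha_T₁, beta_T₁, gamma_zero_T₁, smul_zero, add_zero, pow_one, smul_ex, ex_add, ex_degree, adicOrder_eps,
    Nat.cast_le] at h'
  have h2 : 2 ≤ p := hp.out.two_le
  omega

end UnrestrictedWitness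

/-! ## The refutations of the unrestricted slices (every prime `p`) -/

open UnrestrictedWitness ExponentZeroWitness in
/-- **[OURS · L1 W2.1] `¬ OrderBoundOnPos p ⊤` for every prime `p`**: the CORRECTED (`e > 0`) Case-(I) order bound
WITHOUT a class restriction fails — witness `ε = y x^{2p} + y x^p + x^{2p} ∈ 𝔽_p⟦y,x⟧`, `e = 1`, Case (I),
`ord H♭(ε) = p < p + 1 = ord ε` (at `p = 2` this is res-adj-2's W2). So the class restriction of the slot theorems
(`LucasClass`, `ExactClass`, `MinDegreeTop`/`TopDegreeLeOrder`) is NECESSARY. NOT a statement about the manuscript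
(the unrestricted typed claim is GAP row R05's object, adjudicated in the cell, not here). [folklore] -/
theorem not_orderBoundOnPos_top (p : ℕ) [Fact p.Prime] : ¬ OrderBoundOnPos p (fun _ _ _ _ => True) := by
  intro h
  have hle := (h (ZMod p) 2 1 3 Nat.one_pos (UnrestrictedWitness.eps p) (UnrestrictedWitness.stdExpr p)
    (frontierLength_T₁_pos p) (UnrestrictedWitness.standing p) (UnrestrictedWitness.isCaseI p) trivial).trans
    (UnrestrictedWitness.adicOrder_caseI_le p _ (UnrestrictedWitness.standing_unit_eq p))
  rw [UnrestrictedWitness.adicOrder_eps, Nat.cast_le] at hle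
  omega

/-- **[OURS · L1 W2.1] `¬ OrderBoundOn p ⊤` for every prime `p`** (the v1 all-`e` form implies the `e > 0` form).
[folklore] -/
theorem not_orderBoundOn_top (p : ℕ) [Fact p.Prime] : ¬ OrderBoundOn p (fun _ _ _ _ => True) :=
  fun h => not_orderBoundOnPos_top p fun K _ _ n e ℓ _ ε S h0 hS hI hC => h K n e ℓ ε S h0 hS hI hC

open UnrestrictedWitness ExponentZeroWitness in
/-- **[OURS · L1 W2.1] `¬ DisplayedChainOn p ⊤` for every prime `p`**: the AS-PRINTED display of Rem. 9.9 (1) (typed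
candidate `S09LLUED.Rem9_9_1`), read in `K⟦x⟧` under `Standing` and Case (I) WITHOUT a class restriction, fails — by
`displayedChainIffTopDegreeLe_holds` it would put the witness in class (D), but `|α+pβ+qγ₀| = 2p + 1 > p + 1 = ord ε`.
The restricted forms `DisplayedChainOn p TopDegreeLeOrder` / `DisplayedChainOn p MinDegreeTop` are theorems (p475843).
NOT a statement about the manuscript. [folklore] -/
theorem not_displayedChainOn_top (p : ℕ) [Fact p.Prime] : ¬ DisplayedChainOn p (fun _ _ _ _ => True) := by
  intro h
  have hR := h (ZMod p) 2 1 3 (UnrestrictedWitness.eps p) (UnrestrictedWitness.stdExpr p) (frontierLength_T₁_pos p)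
    (UnrestrictedWitness.standing p) (UnrestrictedWitness.isCaseI p) trivial
  exact UnrestrictedWitness.not_topDegreeLeOrder p
    ((displayedChainIffTopDegreeLe_holds p (ZMod p) 2 1 3 (UnrestrictedWitness.eps p) (UnrestrictedWitness.stdExpr p)
      (frontierLength_T₁_pos p) (UnrestrictedWitness.standing p) (UnrestrictedWitness.isCaseI p)).1 hR)

end CampaignW21

end Summit.ResolutionOfSingularities.ResolutionOfSingularities.Theorems

end
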